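import Summits.CriticalPhenomena.PercolationContinuityZ3.Theorems.PercNearOneGluingNoHeavyQuantGatedProductHull
import HarnessLib

/-!
# QUANT lane R8: THE HULL CONJECTURES ARE FALSE — `¬ LawDec.GatedProductHullLight` and `¬ LawDec.GatedProductHull` (kernel refutation with
# an explicit five-vertex tree and a finite vertex bound)

builds on p205010 (kernel theorem, internal audit signed; external expert review pending)

Support file (`--supports stmt-CriticalPhenomena-4575`), QUANT lane lead seat prim-quant-lead (gen 39); RULING V379, LEAD-NOTES-G39 N6–N7
(`run/shared/lean/prim/quant/`).  Definitions (the separating functional, the witness law, the finite vertex bound `Phi0..Phi4`) + theorems;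
standard axioms, no sorries.  It refutes the two `@[conjecture]`s of `…QuantGatedProductHull` (typer g35, p388237): `GatedProductHullLight`
(every tree-built law at a floor `x < 1/2` is a finite common-mean mixture of gated iterated convolutions of heavy-top laws) and, a fortiori,
`GatedProductHull` (all floors; `gatedProductHullLight_of_gatedProductHull`).  Typer g35's `GatedPairHull` (pairs; not in the tree) is the
two-factor special case and falls with them.

THE WITNESS.  The tree 'SURE root relay → vertex (gate `99/100`, relay) → two leaves (gates `4/5`, `12/25`)' has relay-count law
`μ = δ₁ ∗ gate_{99/100}(δ₁ ∗ R_{4/5} ∗ R_{12/25}) = (0, 1/100, 1287/12500, 1584/3125, 1188/3125)` on `{0..4}` (`cexMu`, `cex_law`), is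
`TreeBuilt` at floor `19/40 < 1/2` (`cex_treeBuilt`; relay marginals `1, .99, .792, .4752`), and has mean `8143/2500`.

THE ARGUMENT (`not_gatedProductHullLight`).  (1) `μ 0 = 0`, and a gated component `gate P s` has zero atom `≥ 1 − s`, so every positively
weighted component has `s = 1` (ungated).  (2) Its mean is then `8143/2500 > 3`, and a law on `{0..N}` has mean `≤ N`, so `N = 4`.
(3) VERTEX BOUND: a linear functional `g` against a heavy-top law `A` on `{0..n}` (`A n ≥ y`) is at most the larger of its values at the
vertices `δ_n` and `(1−y)δ_a + y δ_n` of the heavy-top polytope (`ht_functional_le`: with `t = A n`, `(t − y)(g n − B) ≤ 0`); iterating over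
the factors of an `HTProd` (`functional_lconv` regroups `Σ g·(P ∗ A)` by the last factor) bounds `Σ g·P` by the finite nested maximum
`Phi y g 4` over all products of vertex laws of total size `4` (`HTProd.functional_le_Phi`, levels `0..4`, the transforms
`g ↦ g(·+m)` and `g ↦ (1−y)g(·+a) + y g(·+m)`).  (4) For `f = (−1, 41/50, −41/50, 1, −1)` and `y = 19/40`: `Phi (19/40) f 4 ≤ 1/20`
(`Phi4_cexF_le`, `norm_num` over the finite tree of vertex products) while `Σ f·μ = 15779/312500 > 1/20`; mixing gives the contradiction.
The certificate was found by an exact finite LP (lead g39, kit j230583/j230647; `run/shared/lean/prim/quant/prim-quant-lead-g39/explore/light_cex2.py`):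
under a sure relay the conjectured decomposition loses its gate freedom, and near a tied light floor the heavy-top products of the forced size
cannot reproduce the law.  The failure band is floors ≈ (.41, .5) at tied declaration; at declared floors ≤ .47 the same law IS a member —
which is why the ≈ 2 800 earlier column-generation tests (gates < 1, slack floors) saw no failure.

HONEST STATUS: this closes `GatedProductHull`, `GatedProductHullLight` (and `GatedPairHull`) NEGATIVELY; `Quant.FarTreeRow` and the
closure nodes `SingleGateConvClosed`, `GatedConvEmptyFree` remain OPEN; the unconditional hull tools (`sdec_of_top_ge`, TWO-HT,
`HTProd.row`) are unaffected.  Nothing here is a published result. [this work]; product measure [cite: Grimmett1999, §1.3 p. 10]; the gluing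
rows served [cite: KozmaNitzan2024, Conjecture 3 (p. 15)].
-/

noncomputable section

namespace Summit.CriticalPhenomena.PercolationContinuityZ3.Theorems

namespace Quant

open Finset

namespace LawDec

/-! ### A linear functional against a heavy-top law is controlled by its values at the vertices `δ_n`, `(1−y)δ_a + y·δ_n` -/

/-- **vertex bound for one heavy-top factor.**  If `A` is a heavy-top law at floor `y < 1` on `{0..n}` and a functional `g` satisfies
`g n ≤ B` and `(1−y)·g a + y·g n ≤ B` for every `a < n` (its values at the vertices of the heavy-top polytope), then `Σ g·A ≤ B`.
Proof: with `t = A n ≥ y` the rest mass is `1 − t` and each `g a ≤ (B − y·g n)/(1−y)`, so the sum is `≤ (1−t)(B − y g n)/(1−y) + t g n ≤ B`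
because `(t − y)(g n − B) ≤ 0`. [this work] -/
theorem ht_functional_le (y : ℝ) (n : ℕ) (A : ℕ → ℝ) (hA : HeavyTopLaw y n A) (hy1 : y < 1) (g : ℕ → ℝ) (B : ℝ)
    (hBn : g n ≤ B) (hBa : ∀ a, a < n → (1 - y) * g a + y * g n ≤ B) :
    ∑ h ∈ Finset.range (n + 1), g h * A h ≤ B := by
  obtain ⟨hA0, -, hA1, htop⟩ := hA
  rw [Finset.sum_range_succ] at hA1 ⊢
  -- each lower value: `(1 - y) * g a ≤ B - y * g n`
  have hlow : ∀ a ∈ Finset.range n, g a * A a ≤ (B - y * g n) / (1 - y) * A a := by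
    intro a ha
    have ha' := hBa a (Finset.mem_range.1 ha)
    have h1y : 0 < 1 - y := by linarith
    have : g a ≤ (B - y * g n) / (1 - y) := by rw [le_div_iff₀ h1y]; linarith
    exact mul_le_mul_of_nonneg_right this (hA0 a)
  have hsum : ∑ a ∈ Finset.range n, g a * A a ≤ (B - y * g n) / (1 - y) * ∑ a ∈ Finset.range n, A a := by
    rw [Finset.mul_sum]; exact Finset.sum_le_sum hlow
  have hrest : ∑ a ∈ Finset.range n, A a = 1 - A n := by linarith
  rw [hrest] at hsum
  have h1y : 0 < 1 - y := by linarith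
  -- `(1 - A n)(B - y g n)/(1-y) + g n A n ≤ B`  ⟸  `(A n - y)(g n - B) ≤ 0`
  have key : (B - y * g n) / (1 - y) * (1 - A n) + g n * A n ≤ B := by
    rw [div_mul_eq_mul_div, div_add' _ _ _ (ne_of_gt h1y), div_le_iff₀ h1y]
    nlinarith [htop, hBn, mul_nonneg (sub_nonneg.2 htop) (sub_nonneg.2 hBn)]
  linarith

/-- a functional against a convolution, regrouped by the second factor:
`Σ_h g h · (P ∗ A) h = Σ_k A k · Σ_i P i · g (i + k)`. [this work] -/
theorem functional_lconv (N M : ℕ) (P A : ℕ → ℝ) (g : ℕ → ℝ) :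
    ∑ h ∈ Finset.range (N + M + 1), g h * lconv N M P A h
      = ∑ k ∈ Finset.range (M + 1), A k * ∑ i ∈ Finset.range (N + 1), P i * g (i + k) := by
  simp only [lconv]
  -- push `g h *` inside the double sum
  have e1 : ∀ h ∈ Finset.range (N + M + 1),
      g h * ∑ i ∈ Finset.range (N + 1), ∑ k ∈ Finset.range (M + 1), (if i + k = h then P i * A k else 0)
        = ∑ i ∈ Finset.range (N + 1), ∑ k ∈ Finset.range (M + 1), (if i + k = h then g (i + k) * (P i * A k) else 0) := by
    intro h _
    rw [Finset.mul_sum]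
    refine Finset.sum_congr rfl fun i _ => ?_
    rw [Finset.mul_sum]
    refine Finset.sum_congr rfl fun k _ => ?_
    split_ifs with hik
    · rw [hik]
    · rw [mul_zero]
  rw [Finset.sum_congr rfl e1, Finset.sum_comm]
  -- for each `i`: swap `h` and `k`, collapse the indicator
  have e2 : ∀ i ∈ Finset.range (N + 1),
      ∑ h ∈ Finset.range (N + M + 1), ∑ k ∈ Finset.range (M + 1), (if i + k = h then g (i + k) * (P i * A k) else 0)
        = ∑ k ∈ Finset.range (M + 1), g (i + k) * (P i * A k) := by
    intro i hi
    rw [Finset.sum_comm]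
    refine Finset.sum_congr rfl fun k hk => ?_
    rw [Finset.mem_range] at hi hk
    rw [Finset.sum_eq_single (i + k)]
    · rw [if_pos rfl]
    · intro h _ hne; rw [if_neg (Ne.symm hne)]
    · intro hn; exact absurd (Finset.mem_range.2 (by omega)) hn
  rw [Finset.sum_congr rfl e2, Finset.sum_comm]
  refine Finset.sum_congr rfl fun k _ => ?_
  rw [Finset.mul_sum]
  exact Finset.sum_congr rfl fun i _ => by ring

/-! ### The finite vertex bound `Phi` (levels `0..4`): every product of extreme heavy-top laws, as a nested `max` -/

/-- level-0 vertex bound: the values of `g` against every product of vertex heavy-top laws of total size `0` (right-nested `max`). -/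
def Phi0 (_y : ℝ) (g : ℕ → ℝ) : ℝ :=
  g 0

/-- level-1 vertex bound: the values of `g` against every product of vertex heavy-top laws of total size `1` (right-nested `max`). -/
def Phi1 (y : ℝ) (g : ℕ → ℝ) : ℝ :=
  max (g 1) (max ((1 - y) * g 0 + y * g 1) (max (Phi0 y (fun i => g (i + 1))) (Phi0 y (fun i => (1 - y) * g (i + 0) + y * g (i + 1)))))

/-- level-2 vertex bound: the values of `g` against every product of vertex heavy-top laws of total size `2` (right-nested `max`). -/
def Phi2 (y : ℝ) (g : ℕ → ℝ) : ℝ :=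
  max (g 2) (max ((1 - y) * g 0 + y * g 2) (max ((1 - y) * g 1 + y * g 2) (max (Phi1 y (fun i => g (i + 1))) (max (Phi1 y (fun i => (1 - y) * g (i + 0) + y * g (i + 1))) (max (Phi0 y (fun i => g (i + 2))) (max (Phi0 y (fun i => (1 - y) * g (i + 0) + y * g (i + 2))) (Phi0 y (fun i => (1 - y) * g (i + 1) + y * g (i + 2)))))))))

/-- level-3 vertex bound: the values of `g` against every product of vertex heavy-top laws of total size `3` (right-nested `max`). -/
def Phi3 (y : ℝ) (g : ℕ → ℝ) : ℝ :=
  max (g 3) (max ((1 - y) * g 0 + y * g 3) (max ((1 - y) * g 1 + y * g 3) (max ((1 - y) * g 2 + y * g 3) (max (Phi2 y (fun i => g (i + 1))) (max (Phi2 y (fun i => (1 - y) * g (i + 0) + y * g (i + 1))) (max (Phi1 y (fun i => g (i + 2))) (max (Phi1 y (fun i => (1 - y) * g (i + 0) + y * g (i + 2))) (max (Phi1 y (fun i => (1 - y) * g (i + 1) + y * g (i + 2))) (max (Phi0 y (fun i => g (i + 3))) (max (Phi0 y (fun i => (1 - y) * g (i + 0) + y * g (i + 3))) (max (Phi0 y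 (fun i => (1 - y) * g (i + 1) + y * g (i + 3))) (Phi0 y (fun i => (1 - y) * g (i + 2) + y * g (i + 3))))))))))))))

/-- level-4 vertex bound: the values of `g` against every product of vertex heavy-top laws of total size `4` (right-nested `max`). -/
def Phi4 (y : ℝ) (g : ℕ → ℝ) : ℝ :=
  max (g 4) (max ((1 - y) * g 0 + y * g 4) (max ((1 - y) * g 1 + y * g 4) (max ((1 - y) * g 2 + y * g 4) (max ((1 - y) * g 3 + y * g 4) (max (Phi3 y (fun i => g (i + 1))) (max (Phi3 y (fun i => (1 - y) * g (i + 0) + y * g (i + 1))) (max (Phi2 y (fun i => g (i + 2))) (max (Phi2 y (fun i => (1 - y) * g (i + 0) + y * g (i + 2))) (max (Phi2 y (fun i => (1 - y) * g (i + 1) + y * g (i + 2))) (max (Phi1 y (fun i => g (i + 3))) (max (Phi1 y (fun i => (1 - y) * g (i + 0) + y * g (i + 3))) (max (Phi1 y (fun i => (1 - y) * g (i + 1) + y * g (i + 3))) (max (Phi1 y (fun i => (1 - y) * g (i + 2) + y * g (i + 3))) (max (Phi0 y (fun i => g (i + 4))) (max (Phi0 y (fun i => (1 - y) * g (i + 0)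 + y * g (i + 4))) (max (Phi0 y (fun i => (1 - y) * g (i + 1) + y * g (i + 4))) (max (Phi0 y (fun i => (1 - y) * g (i + 2) + y * g (i + 4))) (Phi0 y (fun i => (1 - y) * g (i + 3) + y * g (i + 4))))))))))))))))))))

/-- the level-indexed bound (levels above `4` are not needed and set to `0`). [this work] -/
def Phi (y : ℝ) (g : ℕ → ℝ) : ℕ → ℝ
  | 0 => Phi0 y g
  | 1 => Phi1 y g
  | 2 => Phi2 y g
  | 3 => Phi3 y g
  | 4 => Phi4 y g
  | _ => 0

/-- the single-law top vertex `δ_n`. [this work] -/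
theorem Phi_top (y : ℝ) (g : ℕ → ℝ) : ∀ n, n ≤ 4 → g n ≤ Phi y g n := by
  intro n hn
  interval_cases n <;> simp only [Phi, Phi0, Phi1, Phi2, Phi3, Phi4, le_max_iff, le_refl, true_or, or_true]

/-- the single-law vertices `(1−y)δ_a + y δ_n`. [this work] -/
theorem Phi_svtx (y : ℝ) (g : ℕ → ℝ) : ∀ n a, n ≤ 4 → a < n → (1 - y) * g a + y * g n ≤ Phi y g n := by
  intro n a hn ha
  interval_cases n <;> interval_cases a <;> simp only [Phi, Phi0, Phi1, Phi2, Phi3, Phi4, le_max_iff, le_refl, true_or, or_true]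

/-- the split by a vertex factor `δ_M`: level `N` bound of the shifted functional. [this work] -/
theorem Phi_shift (y : ℝ) (g : ℕ → ℝ) : ∀ N M, 1 ≤ M → N + M ≤ 4 →
    Phi y (fun i => g (i + M)) N ≤ Phi y g (N + M) := by
  intro N M hM hNM
  have hN : N ≤ 3 := by omega
  have hM4 : M ≤ 4 := by omega
  interval_cases N <;> interval_cases M <;> first | (exfalso; omega) | simp only [Phi, Phi0, Phi1, Phi2, Phi3, Phi4, le_max_iff, le_refl, true_or, or_true]

/-- the split by a vertex factor `(1−y)δ_a + y δ_M`. [this work] -/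
theorem Phi_vtx (y : ℝ) (g : ℕ → ℝ) : ∀ N M a, 1 ≤ M → N + M ≤ 4 → a < M →
    Phi y (fun i => (1 - y) * g (i + a) + y * g (i + M)) N ≤ Phi y g (N + M) := by
  intro N M a hM hNM ha
  have hN : N ≤ 3 := by omega
  have hM4 : M ≤ 4 := by omega
  interval_cases N <;> interval_cases M <;> first | (exfalso; omega) | (interval_cases a <;> simp only [Phi, Phi0, Phi1, Phi2, Phi3, Phi4, le_max_iff, le_refl, true_or, or_true])

/-! ### The master bound: heavy-top products of total size `n ≤ 4` lie under `Phi` -/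

/-- **every iterated convolution of heavy-top laws of total size `n ≤ 4` satisfies `Σ g·P ≤ Phi y g n` for EVERY functional `g`**
(induction on the product: one factor = `ht_functional_le` with the single-law vertices; a further factor `A` of size `M` = regroup by `A`
(`functional_lconv`) and apply `ht_functional_le` to `A` with the induction hypothesis on the shifted / vertex-mixed functionals). [this work] -/
theorem HTProd.functional_le_Phi {y : ℝ} {n : ℕ} {P : ℕ → ℝ} (h : HTProd y n P) (hy1 : y < 1) :
    n ≤ 4 → ∀ g : ℕ → ℝ, ∑ k ∈ Finset.range (n + 1), g k * P k ≤ Phi y g n := by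
  induction h with
  | @one M A hA =>
    intro hn g
    exact ht_functional_le y M A hA hy1 g _ (Phi_top y g M hn) (fun a ha => Phi_svtx y g M a hn ha)
  | @mul N M P A hP hA ih =>
    intro hn g
    rw [functional_lconv]
    have hN : N ≤ 4 := by omega
    -- the inner functional `G k = Σ_i P i · g (i + k)`, bounded through the induction hypothesis
    have hG : ∀ k, ∑ i ∈ Finset.range (N + 1), P i * g (i + k) = ∑ i ∈ Finset.range (N + 1), (fun i => g (i + k)) i * P i := by
      intro k; exact Finset.sum_congr rfl fun i _ => by ring
    rcases Nat.eq_zero_or_pos M with hM0 | hMpos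
    · -- a factor of size 0 is `δ₀`: the sum has one term
      subst hM0
      obtain ⟨hA0, -, hA1, -⟩ := hA
      rw [zero_add, Finset.sum_range_one] at hA1
      rw [zero_add, Finset.sum_range_one, hA1, one_mul, hG 0]
      have := ih hN (fun i => g (i + 0))
      simp only [Nat.add_zero] at this ⊢
      exact this
    · have eswap : ∀ k, A k * ∑ i ∈ Finset.range (N + 1), P i * g (i + k)
          = (fun k => ∑ i ∈ Finset.range (N + 1), P i * g (i + k)) k * A k := fun k => by ring
      rw [Finset.sum_congr rfl fun k _ => eswap k]
      refine ht_functional_le y M A hA hy1 _ _ ?_ ?_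
      · -- the top vertex `δ_M`: shifted functional
        show ∑ i ∈ Finset.range (N + 1), P i * g (i + M) ≤ Phi y g (N + M)
        rw [hG M]
        exact (ih hN (fun i => g (i + M))).trans (Phi_shift y g N M hMpos hn)
      · intro a ha
        show (1 - y) * (∑ i ∈ Finset.range (N + 1), P i * g (i + a)) + y * (∑ i ∈ Finset.range (N + 1), P i * g (i + M))
          ≤ Phi y g (N + M)
        have e : (1 - y) * (∑ i ∈ Finset.range (N + 1), P i * g (i + a)) + y * (∑ i ∈ Finset.range (N + 1), P i * g (i + M))
            = ∑ i ∈ Finset.range (N + 1), (fun i => (1 - y) * g (i + a) + y * g (i + M)) i * P i := by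
          rw [Finset.mul_sum, Finset.mul_sum, ← Finset.sum_add_distrib]
          exact Finset.sum_congr rfl fun i _ => by ring
        rw [e]
        exact (ih hN _).trans (Phi_vtx y g N M a hMpos hn ha)

/-! ### The witness -/

/-- the separating functional `f = (−1, 41/50, −41/50, 1, −1)` (zero above `4`). [this work] -/
def cexF : ℕ → ℝ := fun h =>
  if h = 0 then -1 else if h = 1 then 41 / 50 else if h = 2 then -(41 / 50) else if h = 3 then 1 else if h = 4 then -1 else 0

/-- **the numeric fact**: every product of extreme heavy-top laws at floor `19/40` of total size `4` has `f`-value `≤ 1/20`. [this work] -/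
theorem Phi4_cexF_le : Phi (19 / 40 : ℝ) cexF 4 ≤ 1 / 20 := by
  show Phi4 (19 / 40 : ℝ) cexF ≤ 1 / 20
  norm_num [Phi4, Phi3, Phi2, Phi1, Phi0, cexF]

/-- the witness law `μ = δ₁ ∗ gate_{99/100}(δ₁ ∗ R_{4/5} ∗ R_{12/25}) = (0, 1/100, 1287/12500, 1584/3125, 1188/3125)` — the relay count of
the tree 'sure root relay → vertex (gate 99/100, relay) → two leaves (gates 4/5 and 12/25)'. [this work] -/
def cexMu : ℕ → ℝ := fun h =>
  if h = 1 then 1 / 100 else if h = 2 then 1287 / 12500 else if h = 3 then 1584 / 3125 else if h = 4 then 1188 / 3125 else 0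

/-- the unit relay law `δ₁`. -/
private def d1 : ℕ → ℝ := fun h => if h = 1 then (1 : ℝ) else 0

/-- step 1: the two leaves `R_{4/5} ∗ R_{12/25} = (13/125, 64/125, 48/125)`. [this work] -/
theorem cex_leaves : lconv 1 1 (gate d1 (4 / 5)) (gate d1 (12 / 25))
    = fun h => if h = 0 then 13 / 125 else if h = 1 then 64 / 125 else if h = 2 then (48 / 125 : ℝ) else 0 := by
  funext h
  rcases Nat.lt_or_ge h 3 with hh | hh
  · simp only [lconv, gate, d1, Finset.sum_range_succ, Finset.sum_range_zero]
    interval_cases h <;> norm_num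
  · rw [lconv_eq_zero _ _ _ _ h (by omega), if_neg (by omega), if_neg (by omega), if_neg (by omega)]

/-- step 2: the gated vertex with its relay, `gate_{99/100}(δ₁ ∗ (R ∗ R)) = (1/100, 1287/12500, 1584/3125, 1188/3125)`. [this work] -/
theorem cex_vertex : gate (lconv 1 2 d1 (lconv 1 1 (gate d1 (4 / 5)) (gate d1 (12 / 25)))) (99 / 100)
    = fun h => if h = 0 then 1 / 100 else if h = 1 then 1287 / 12500 else if h = 2 then 1584 / 3125
      else if h = 3 then (1188 / 3125 : ℝ) else 0 := by
  rw [cex_leaves]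
  funext h
  rcases Nat.lt_or_ge h 4 with hh | hh
  · simp only [lconv, gate, d1, Finset.sum_range_succ, Finset.sum_range_zero]
    interval_cases h <;> norm_num
  · rw [gate_apply, lconv_eq_zero _ _ _ _ h (by omega), if_neg (by omega), if_neg (by omega), if_neg (by omega),
      if_neg (by omega), if_neg (by omega)]
    ring

/-- step 3: with the sure root relay, the witness law. [this work] -/
theorem cex_law : lconv 1 3 d1 (gate (lconv 1 2 d1 (lconv 1 1 (gate d1 (4 / 5)) (gate d1 (12 / 25)))) (99 / 100)) = cexMu := by
  rw [cex_vertex]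
  funext h
  rcases Nat.lt_or_ge h 5 with hh | hh
  · simp only [lconv, d1, cexMu, Finset.sum_range_succ, Finset.sum_range_zero]
    interval_cases h <;> norm_num
  · rw [lconv_eq_zero _ _ _ _ h (by omega)]
    simp only [cexMu]
    rw [if_neg (by omega), if_neg (by omega), if_neg (by omega), if_neg (by omega)]

/-- **the witness is tree-built at floor `19/40`** (leaves at floors `(4/5)a`, `(12/25)a` → common floor by `mono` → `conv` → sure relay →
gate `99/100` → sure relay; `a = 2375/2376` makes the final floor `99/100 · 12/25 · a = 19/40`). [this work] -/
theorem cex_treeBuilt : TreeBuilt (19 / 40 : ℝ) 4 cexMu := by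
  have ha0 : (0 : ℝ) < 2375 / 2376 := by norm_num
  have ha1 : (2375 / 2376 : ℝ) < 1 := by norm_num
  -- the two leaves
  have hc : TreeBuilt (4 / 5 * (2375 / 2376 : ℝ)) 1 (gate d1 (4 / 5)) :=
    TreeBuilt.gate (4 / 5) (by norm_num) (by norm_num) (TreeBuilt.relay _ ha0 ha1)
  have hd : TreeBuilt (12 / 25 * (2375 / 2376 : ℝ)) 1 (gate d1 (12 / 25)) :=
    TreeBuilt.gate (12 / 25) (by norm_num) (by norm_num) (TreeBuilt.relay _ ha0 ha1)
  have hc' : TreeBuilt (12 / 25 * (2375 / 2376 : ℝ)) 1 (gate d1 (4 / 5)) :=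
    TreeBuilt.mono hc (by norm_num) (by norm_num)
  have hcd : TreeBuilt (12 / 25 * (2375 / 2376 : ℝ)) (1 + 1) (lconv 1 1 (gate d1 (4 / 5)) (gate d1 (12 / 25))) :=
    TreeBuilt.conv hc' hd
  -- the relay at the gated vertex, then the gate 99/100
  have hr : TreeBuilt (12 / 25 * (2375 / 2376 : ℝ)) 1 d1 := TreeBuilt.relay _ (by norm_num) (by norm_num)
  have hv : TreeBuilt (12 / 25 * (2375 / 2376 : ℝ)) (1 + (1 + 1)) (lconv 1 2 d1 (lconv 1 1 (gate d1 (4 / 5)) (gate d1 (12 / 25)))) :=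
    TreeBuilt.conv hr hcd
  have hg : TreeBuilt (99 / 100 * (12 / 25 * (2375 / 2376 : ℝ))) (1 + (1 + 1))
      (gate (lconv 1 2 d1 (lconv 1 1 (gate d1 (4 / 5)) (gate d1 (12 / 25)))) (99 / 100)) :=
    TreeBuilt.gate (99 / 100) (by norm_num) (by norm_num) hv
  -- the sure root relay
  have hr' : TreeBuilt (99 / 100 * (12 / 25 * (2375 / 2376 : ℝ))) 1 d1 := TreeBuilt.relay _ (by norm_num) (by norm_num)
  have hall := TreeBuilt.conv hr' hg
  rw [cex_law] at hall
  have e : (99 / 100 * (12 / 25 * (2375 / 2376 : ℝ))) = 19 / 40 := by norm_num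
  rw [e] at hall
  exact hall

/-! ### The refutation -/

/-- **`LawDec.GatedProductHullLight` IS FALSE.**  The witness `cexMu` (floor `19/40 < 1/2`, `M = 4`) has `cexMu 0 = 0`, so every
mixture component `gate (P i) (s i)` with positive weight has `s i = 1`; its mean `8143/2500 > 3` forces `N i = 4`; by
`HTProd.functional_le_Phi` and `Phi4_cexF_le` every such component has `f`-value `≤ 1/20`, while `Σ f·cexMu = 15779/312500 > 1/20`.
[this work] -/
theorem not_gatedProductHullLight : ¬ GatedProductHullLight := by
  intro hH
  obtain ⟨ι, hι, w, s, N, P, hw0, hw1, hs, hP, hNM, hmean, hmix⟩ :=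
    hH (19 / 40) 4 cexMu cex_treeBuilt (by norm_num)
  -- the two numbers of the witness
  have hval : ∑ h ∈ Finset.range (4 + 1), cexF h * cexMu h = 15779 / 312500 := by
    simp only [Finset.sum_range_succ, Finset.sum_range_zero, cexF, cexMu]; norm_num
  have hmeanW : ∑ h ∈ Finset.range (4 + 1), (h : ℝ) * cexMu h = 8143 / 2500 := by
    simp only [Finset.sum_range_succ, Finset.sum_range_zero, cexMu]; norm_num
  have hzeroW : cexMu 0 = 0 := by simp [cexMu]
  -- every positively weighted component is ungated
  have hterm0 : ∀ i, w i * gate (P i) (s i) 0 = 0 := by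
    have hsum : ∑ i, w i * gate (P i) (s i) 0 = 0 := by rw [← hmix 0, hzeroW]
    have hnn : ∀ i ∈ (Finset.univ : Finset ι), 0 ≤ w i * gate (P i) (s i) 0 := by
      intro i _
      refine mul_nonneg (hw0 i) ?_
      rw [gate_apply, if_pos rfl, mul_one]
      have := (hP i).lawFacts.1 0
      nlinarith [(hs i).1, (hs i).2]
    exact fun i => (Finset.sum_eq_zero_iff_of_nonneg hnn).1 hsum i (Finset.mem_univ i)
  have hs1 : ∀ i, 0 < w i → s i = 1 := by
    intro i hi
    have h0 := hterm0 i
    rw [mul_eq_zero] at h0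
    rcases h0 with h0 | h0
    · exact absurd h0 (ne_of_gt hi)
    · rw [gate_apply, if_pos rfl, mul_one] at h0
      have := (hP i).lawFacts.1 0
      nlinarith [(hs i).1, (hs i).2, mul_nonneg (le_of_lt ((show (0:ℝ) < 19/40 by norm_num).trans (hs i).1)) this]
  -- ... and has total size exactly 4
  have hN4 : ∀ i, 0 < w i → N i = 4 := by
    intro i hi
    have hm := hmean i
    rw [hs1 i hi, one_mul, hmeanW] at hm
    obtain ⟨hP0, hPN, hP1⟩ := (hP i).lawFacts
    have hle : ∑ h ∈ Finset.range (N i + 1), (h : ℝ) * P i h ≤ (N i : ℝ) := by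
      calc ∑ h ∈ Finset.range (N i + 1), (h : ℝ) * P i h ≤ ∑ h ∈ Finset.range (N i + 1), (N i : ℝ) * P i h :=
            Finset.sum_le_sum fun h hh => mul_le_mul_of_nonneg_right
              (by exact_mod_cast Nat.le_of_lt_succ (Finset.mem_range.1 hh)) (hP0 h)
        _ = (N i : ℝ) := by rw [← Finset.mul_sum, hP1, mul_one]
    rw [hm] at hle
    have h4 : (3 : ℝ) < N i := by linarith
    have h4' : 3 < N i := by exact_mod_cast h4
    have := hNM i
    omega
  -- each component's `f`-value is at most `1/20`
  have hcomp : ∀ i, w i * ∑ h ∈ Finset.range (4 + 1), cexF h * gate (P i) (s i) h ≤ w i * (1 / 20) := by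
    intro i
    rcases (hw0 i).eq_or_lt with hz | hpos
    · rw [← hz, zero_mul, zero_mul]
    · refine mul_le_mul_of_nonneg_left ?_ (hw0 i)
      have hPi := hP i
      rw [hs1 i hpos, div_one, hN4 i hpos] at hPi
      rw [hs1 i hpos, gate_one]
      exact (hPi.functional_le_Phi (by norm_num) le_rfl cexF).trans Phi4_cexF_le
  -- sum up: `15779/312500 = Σ_i w_i · (f·component_i) ≤ Σ_i w_i / 20 = 1/20`
  have hmixF : ∑ h ∈ Finset.range (4 + 1), cexF h * cexMu h = ∑ i, w i * ∑ h ∈ Finset.range (4 + 1), cexF h * gate (P i) (s i) h := by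
    have e : ∀ h ∈ Finset.range (4 + 1), cexF h * cexMu h = ∑ i, cexF h * (w i * gate (P i) (s i) h) := by
      intro h _; rw [hmix h, Finset.mul_sum]
    rw [Finset.sum_congr rfl e, Finset.sum_comm]
    refine Finset.sum_congr rfl fun i _ => ?_
    rw [Finset.mul_sum]
    exact Finset.sum_congr rfl fun h _ => by ring
  have hle : ∑ h ∈ Finset.range (4 + 1), cexF h * cexMu h ≤ 1 / 20 := by
    rw [hmixF]
    calc ∑ i, w i * ∑ h ∈ Finset.range (4 + 1), cexF h * gate (P i) (s i) h ≤ ∑ i, w i * (1 / 20) :=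
          Finset.sum_le_sum fun i _ => hcomp i
      _ = 1 / 20 := by rw [← Finset.sum_mul, hw1, one_mul]
  rw [hval] at hle
  norm_num at hle

/-- **`LawDec.GatedProductHull` (all floors) IS FALSE** as well (it implies the light form, `gatedProductHullLight_of_gatedProductHull`).
An independent heavy-floor witness is recorded in the lane notes (LEAD-NOTES-G39 N6). [this work] -/
theorem not_gatedProductHull : ¬ GatedProductHull :=
  fun hH => not_gatedProductHullLight (gatedProductHullLight_of_gatedProductHull hH)

end LawDec

end Quant

end Summit.CriticalPhenomena.PercolationContinuityZ3.Theorems
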